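import Literature.NumberTheory.Automorphic.ShimuraCurveTakahashiCoordinateInputs
import Literature.NumberTheory.EllipticCurves.Rank1Residual.Predicates
import HarnessLib

/-!
# Route `RamifiedHeegnerPair`, crux U₁ `LeafRankOneUpperAtThree` (stmt-BirchSwinnertonDyer-26022), line `partnerdescent` —
# partner kernel: (G3♭ˢ) BY NAME from the four printed coordinate inputs and the FIFTH PROPERTY IN TAKAHASHI COORDINATES

HONEST FRAMING. Theorems only; helper file (`--supports stmt-BirchSwinnertonDyer-26022 --as helper`); plumbing over the tree's
`Literature.NumberTheory.Automorphic.ShimuraCurveTakahashiCoordinateInputs` (four NAMED FACTS = the printed inputs of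
`PastenShimura2024_componentOrders`) and `…ShimuraCurveRibetTakahashiComponentOrdersCoordinatesProofs` (the coupled selection
`selection_level` ∕ `selection_disc` ∕ `selection_pos` and `productEq/prop613/imageEisenstein/cokernelDvd_of_coordinates`); no number
theory of its own, no named fact, no `sorry`; nothing booked; BSD is proved for no curve. Lead prover bsd-line-rhp-p2 g63, 2026-08-31.

WHY. The line's stub (G3♭ˢ) `Partnerdescent.stub_partnerCokernelThreeFreeFlatSplit` asks for Pasten's component-order package — Skolem
functions `cI, cJ` with the FOUR printed properties (Π), (6.13), (6.14), (6.18) — TOGETHER WITH the fifth property «`3 ∤ cJ P r`» at a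
PAIR level `D = qr` for a `3`-good partner `V` (`ρ̄_{V,3}` irreducible, `V` split multiplicative at `q`, `#V(ℚ_q)[3] ≠ 9`). The named
fact `PastenShimura2024_componentOrders` cannot serve: its `cJ` is anonymous. But the tree (seat of `ShimuraCurveTakahashiCoordinateInputs`)
derives that fact BY NAME from four separately cited printed statements in Brandt coordinates — `takahashi2001_thm_2_3_shimura_level`,
`takahashi2001_thm_2_3_shimura_disc`, `PastenShimura2024_lemma_6_14_imageOrder_dvd`, `PastenShimura2024_lemma_6_18_cokernelOrder_dvd` —
through the COUPLED SELECTION of the (unique) solution `(i, j)` of Takahashi's system `i·j = ord_p Δ_min(A)`, `δ·i = ξ_S·j` on the side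
where `p` lives. Running the same selection, the fifth property of the selected `cJ P r` is EXACTLY the following closed formula in
Takahashi's coordinates (hypothesis `h5` below, the line's new stub (G3♭ᶜ)):

  for `N = DM` admissible, `D = p·d`, `W` of conductor `N` with `3 ∤ N`, `ρ̄_{W,3}` irreducible, `W` split multiplicative at the prime
  `d ≠ p` with `#W(ℚ_d)[3] ≠ 9`, `P` class-minimal for `W` on `X₀^D(M)` (curve `W′`), every Brandt setup `S` of type `(pM, d)` and every
  solution `(i, j)`, `i > 0`, of `i·j = ord_p Δ_min(W′)`, `P.deg·i = ξ_S(a(W′))·j`: `3 ∤ j`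

— i.e. `ord₃ δ_{D,M} + ord₃ c_p = ord₃ ξ_S` (`LeafPartnerOrders.padicValNat_add_eq_iff_not_dvd`, p801913), the statement the landed
algebra package (Gorenstein core p801603, congruence lattice p810424, local factors) derives from multiplicity one at `𝔪_{f,3}`, the
Hecke projector denominators and `δ ∣ η′`. So (G3♭ˢ) = FOUR PRINT FACTS (already typed, cite-only) + (G3♭ᶜ):
`partnerCokernelThreeFreeFlatSplit_of_coordinateInputs`. The conclusion is the workfile predicate `PartnerCokernelThreeFreeFlatSplit`
UNFOLDED VERBATIM (a Theorems file cannot import the Cruxes workfile; the skeleton's bridge is definitional).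
[cite: Takahashi2001, Thm. 2.3 (p. 79), Prop. 3.1 and Thm. 3.2 (a) (p. 82), p. 84] [cite: PastenShimura2024, §6.4 p. 22, §6.6, Prop. 6.13,
Lemma 6.14 (proof) p. 23, Lemma 6.18 pp. 24–25] [cite: PapikianRabinoff2016, Cor. 3.5, Thm. 30, Lemma 32]
-/

set_option linter.dupNamespace false
set_option autoImplicit false

noncomputable section

namespace Summit.BirchSwinnertonDyer.BirchSwinnertonDyer.Theorems.LeafPartnerCokernelFifth

open Literature.NumberTheory.Automorphic Literature.NumberTheory.EllipticCurves

open scoped Classical in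
/-- **(G3♭ˢ) from the four printed coordinate inputs and the fifth property in Takahashi coordinates.** Given the named facts
`takahashi2001_thm_2_3_shimura_level` (Thm. 2.3 at `p ∥ M`, type `(M/p, Dp)`), `takahashi2001_thm_2_3_shimura_disc` (Thm. 2.3 with
Thm. 3.2 (a) at `p ∣ D`, type `(pM, D/p)`), `PastenShimura2024_lemma_6_14_imageOrder_dvd` (Ribet's Eisenstein divisibility of the image
order) and `PastenShimura2024_lemma_6_18_cokernelOrder_dvd` (Papikian–Rabinoff Cor. 3.5), and the FIFTH PROPERTY IN COORDINATES `h5`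
(for every solution `(i, j)` of the discriminant system at a pair level under the (G3♭ˢ) hypotheses on the curve: `3 ∤ j`), the coupled
selection `cI := sel.1`, `cJ := sel.2` of `…ComponentOrdersCoordinatesProofs` (junk `(1,1)` where no system is posed) has the four printed
properties (`productEq/prop613/imageEisenstein/cokernelDvd_of_coordinates`) AND the fifth: at `(P, r)` with `D = q·r` the selected pair
solves the discriminant system in the setup of type `(rM, q)` that exists by admissibility (`nonempty_xiSetup_disc`), so `h5` applies.
The conclusion is `Partnerdescent.PartnerCokernelThreeFreeFlatSplit` unfolded verbatim.
[cite: Takahashi2001, Thm. 2.3 (p. 79), Thm. 3.2 (a) (p. 82)] [cite: PastenShimura2024, §6.6, Prop. 6.13, Lemma 6.14, Lemma 6.18] -/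
theorem partnerCokernelThreeFreeFlatSplit_of_coordinateInputs
    (h₁ : takahashi2001_thm_2_3_shimura_level) (h₂ : takahashi2001_thm_2_3_shimura_disc)
    (h₃ : PastenShimura2024_lemma_6_14_imageOrder_dvd) (h₄ : PastenShimura2024_lemma_6_18_cokernelOrder_dvd)
    (h5 : ∀ {N D M p d : ℕ}, p.Prime → D = p * d → IsAdmissibleFactorization N D M →
      ∀ (X : ShimuraCurveData D M) (W : WeierstrassCurve ℚ) [W.IsElliptic] [W.IsGloballyMinimal],
        W.conductorNorm ℤ = N → ¬ 3 ∣ N → W.HasIrreducibleModPGaloisRep 3 →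
      ∀ [Fact d.Prime], d ≠ p → W.HasSplitMultiplicativeReductionAtPrime d →
        Nat.card (AddSubgroup.torsionBy ((W.baseChange ℚ_[d]).toAffine.Point) 3) ≠ 9 →
      ∀ (W' : WeierstrassCurve ℚ) [W'.IsElliptic] (P : ShimuraParametrizationData X W'), P.IsMinimalFor W →
      ∀ (S : Brandt.XiSetup (p * M) d) (i j : ℕ), 0 < i →
        i * j = (W'.minimalDiscriminantNorm ℤ).factorization p →
        P.deg * i = S.xi (fun n => W'.LFunction n) * j → ¬ 3 ∣ j) :
    ∃ cI cJ : ComponentOrderFun,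
      (∀ {D M : ℕ} {X : ShimuraCurveData D M} {W' : WeierstrassCurve ℚ}
          (P : ShimuraParametrizationData X W') (p : ℕ), 0 < cI P p ∧ 0 < cJ P p) ∧
      ComponentOrders.ProductEq cI cJ ∧ ComponentOrders.Prop613 cI cJ ∧
      ComponentOrders.ImageEisenstein cI ∧ ComponentOrders.CokernelDvd cJ ∧
      (∀ {N D M : ℕ}, IsAdmissibleFactorization N D M →
        ∀ (X : ShimuraCurveData D M) (V : WeierstrassCurve ℚ) [V.IsElliptic] [V.IsGloballyMinimal],
          V.conductorNorm ℤ = N → ¬ 3 ∣ N → Rank1Residual.Irr V 3 →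
        ∀ (q r : ℕ) [Fact q.Prime] [Fact r.Prime], q ≠ r → D = q * r →
          V.HasSplitMultiplicativeReductionAtPrime q →
          Nat.card (AddSubgroup.torsionBy ((V.baseChange ℚ_[q]).toAffine.Point) 3) ≠ 9 →
        ∀ (V' : WeierstrassCurve ℚ) [V'.IsElliptic] (P : ShimuraParametrizationData X V'),
          P.IsMinimalFor V → ¬ 3 ∣ cJ P r) := by
  -- the coupled selection of `…ComponentOrdersCoordinatesProofs` (verbatim)
  let sel : ∀ {D M : ℕ} {X : ShimuraCurveData D M} {W' : WeierstrassCurve ℚ},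
      ShimuraParametrizationData X W' → ℕ → ℕ × ℕ := fun {D M} {_X} {W'} P p =>
    if p ∣ M then
      (if h : ∃ ij : ℕ × ℕ, 0 < ij.1 ∧ 0 < ij.2 ∧
          ij.1 * ij.2 = (W'.minimalDiscriminantNorm ℤ).factorization p ∧
          P.deg * ij.1 = brandtXi (M / p) (D * p) (fun n => W'.LFunction n) * ij.2
        then Classical.choose h else (1, 1))
    else
      (if h : ∃ ij : ℕ × ℕ, 0 < ij.1 ∧ 0 < ij.2 ∧
          ij.1 * ij.2 = (W'.minimalDiscriminantNorm ℤ).factorization p ∧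
          P.deg * ij.1 = brandtXi (p * M) (D / p) (fun n => W'.LFunction n) * ij.2
        then Classical.choose h else (1, 1))
  have hsel : ∀ {D M : ℕ} {X : ShimuraCurveData D M} {W' : WeierstrassCurve ℚ}
      (P : ShimuraParametrizationData X W') (p : ℕ),
      sel P p =
        if p ∣ M then
          (if h : ∃ ij : ℕ × ℕ, 0 < ij.1 ∧ 0 < ij.2 ∧
              ij.1 * ij.2 = (W'.minimalDiscriminantNorm ℤ).factorization p ∧
              P.deg * ij.1 = brandtXi (M / p) (D * p) (fun n => W'.LFunction n) * ij.2
            then Classical.choose h else (1, 1))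
        else
          (if h : ∃ ij : ℕ × ℕ, 0 < ij.1 ∧ 0 < ij.2 ∧
              ij.1 * ij.2 = (W'.minimalDiscriminantNorm ℤ).factorization p ∧
              P.deg * ij.1 = brandtXi (p * M) (D / p) (fun n => W'.LFunction n) * ij.2
            then Classical.choose h else (1, 1)) := fun _ _ => rfl
  refine ⟨fun P p => (sel P p).1, fun P p => (sel P p).2, selection_pos sel hsel,
    productEq_of_coordinates _ _ (selection_level h₁ sel hsel) (selection_disc h₂ sel hsel),
    prop613_of_coordinates _ _ (selection_level h₁ sel hsel) (selection_disc h₂ sel hsel),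
    imageEisenstein_of_coordinates h₃ _ _ (selection_level h₁ sel hsel),
    cokernelDvd_of_coordinates h₄ _ _ (selection_disc h₂ sel hsel), ?_⟩
  intro N D M hadm X V _ _ hN h3 hirr q r _ hr hqr hD hsplit hns V' _ P hP
  -- the discriminant system at `(P, r)`, read in a Brandt setup of type `(rM, q)` (exists by admissibility)
  have hD' : D = r * q := by rw [hD, mul_comm]
  obtain ⟨S⟩ := hadm.nonempty_xiSetup_disc hr.out hD'
  obtain ⟨hi, hij, hδ⟩ := selection_disc h₂ sel hsel hr.out hD' hadm X V hN V' P hP S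
  exact h5 hr.out hD' hadm X V hN h3 hirr hqr hsplit hns V' P hP S _ _ hi hij hδ

end Summit.BirchSwinnertonDyer.BirchSwinnertonDyer.Theorems.LeafPartnerCokernelFifth

end
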